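import Mathlib
import HarnessLib

/-!
# The symmetric-difference (Kikuchi) matrix of order `ℓ`

HONEST FRAMING: instance-level adjudication of specific advantage claims; no claim about
BQP vs BPP or the summit.

Let `Y` be a function on subsets of a finite ground set (an order-`p` symmetric tensor read on
sets of `p` distinct indices, `Y_E`, `|E| = p`).  For an integer `ℓ`, the **symmetric difference
matrix of order `ℓ`** is the symmetric `C(n,ℓ) × C(n,ℓ)` matrix indexed by the `ℓ`-subsets `S, T`
of the ground set with entries
`M_{S,T} = Y_{S ∆ T}` if `|S ∆ T| = p` and `0` otherwise
[cite: WeinElalaouiMoore2019, §3, "The symmetric difference matrix of order ℓ", the displayed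
definition of `M_{S,T}`].  For a `k`-XOR instance with constraint scopes `U_i` and signs `b_i`
the same matrix with `Y_E = Σ_{i : U_i = E} b_i` is the matrix `M = Σ_i M^{(i)}` of
[cite: WeinElalaouiMoore2019, §11.1.2] — nowadays called the level-`ℓ` **Kikuchi matrix**
(Schmidhuber–O'Donnell–Kothari–Babbush, arXiv:2406.19378; Hastings, Quantum 4, 237 (2020)).

Results (all proved; finite combinatorics, `[folklore]` beyond the cited definitions):

* `kikuchi_transpose` / `kikuchi_isSymm` — `M` is symmetric (`S ∆ T = T ∆ S`);
* `prod_symmDiff` — for `x` with `x_i · x_i = 1`: `x^{S ∆ T} = x^S · x^T`, where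
  `x^S := ∏_{i ∈ S} x_i` — the identity behind "conjugate `M` by the diagonal matrix
  `D_{S,S} = x^S` … `x^S x^T Y_{S∆T} = x^{S∆T} Y_{S∆T}`" [cite: WeinElalaouiMoore2019, §6, first
  paragraph];
* `kikuchi_planted_apply` — for the noiseless planted tensor `Y_E = λ · x^E` the entries are
  `λ · x^S · x^T` on the pattern `|S ∆ T| = p` (i.e. `M = λ · D X D` with `X` the adjacency matrix of
  the graph `J_{n,ℓ,p}`, `S ~ T ⇔ |S ∆ T| = p` [cite: WeinElalaouiMoore2019, §6.1]);
* `card_symmDiff_add` — `|S ∆ T| + 2|S ∩ T| = |S| + |T|`, whence for `|S| = |T| = ℓ`: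
  `|S ∆ T| = p ⇔ |S ∩ T| = ℓ - p/2` and `p` is even [cite: WeinElalaouiMoore2019, §6.1,
  "or equivalently `|S ∩ T| = ℓ - p/2`"];
* `kikuchi_planted_mulVec` — the vector `u_S = x^S` satisfies `M u = λ · d · u` entrywise, with
  `d = adjCount p ℓ S` the number of `ℓ`-sets `T` with `|S ∆ T| = p` (so `u` is an eigenvector of
  the signal part with eigenvalue `λ d_ℓ` — the threshold `λ d_ℓ / 2` of the detection algorithm
  [cite: WeinElalaouiMoore2019, §3, Algorithm 9 and Theorem 11]);
* `adjCount_eq` — `d_ℓ = C(ℓ, p/2) · C(n - ℓ, p/2)` for even `p = 2j`, independently of `S`: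
  "This is the number of sets `T` of size `ℓ` such that `|S ∆ T| = p` for a given set `S` of
  size `ℓ`" [cite: WeinElalaouiMoore2019, §3, definition of `d_ℓ`]; and `adjCount_eq_zero_of_odd`;
* `card_filter_symmDiff_eq` — for a fixed `2j`-set `U`, the number of ordered pairs `(S, T)` of
  `ℓ`-sets with `S ∆ T = U` is `C(2j, j) · C(n - 2j, ℓ - j)` (bijection `(S,T) ↦ (S ∩ U, S ∖ U)`),
  the pair count of [cite: WeinElalaouiMoore2019, §11.1.2] that converts the quadratic form
  `dotProduct_kikuchi_mulVec` into `c · Σ_i b_i x^{U_i}` for a `k`-XOR instance.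

Context (cell pub-qadeq, CLAIMS A-24 / A-61 / A-65): the quartic quantum speedups for planted
inference (Schmidhuber et al., PRX 15, 021077 (2025)) and the end-to-end tensor-PCA resource
estimates of Fontana et al. (arXiv:2510.07273, Table 1) are stated for the top eigenvalue of this
matrix at level `ℓ`; `KikuchiLevelSelection.lean` holds the instance arithmetic for Table 1 and
DEQ-A61 (HOME/pub-qadeq-harvest-1/) the level-2 numerics.  This file supplies the generic object
and the exact planted-signal algebra only; no probabilistic statement (matrix Chernoff, detection
thresholds) is formalised here.

## References

Section numbers in the `[cite: WeinElalaouiMoore2019, §…]` locators are those of the arXiv source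
arXiv:1904.03858 as held by `lit` (§3 "Main results", §6 "Analysis of symmetric difference and
voting matrices", §6.1 "Structure of X", §7 "Detection for general priors", §11.1 "Refuting random
k-XOR formulas for k even", §11.1.2 "Algorithm"); in the proceedings version (FOCS 2019,
pp. 1446–1468, doi:10.1109/focs.2019.000-2) and the journal version (J. ACM 2025,
doi:10.1145/3762806) §6, §7 and §11 are appendices with the same titles.

* A. S. Wein, A. El Alaoui, C. Moore, *The Kikuchi Hierarchy and Tensor PCA*, FOCS 2019,
  1446–1468; J. ACM (2025); arXiv:1904.03858.
* A. Schmidhuber, R. O'Donnell, R. Kothari, R. Babbush, *Quartic quantum speedups for planted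
  inference*, Phys. Rev. X 15, 021077 (2025), arXiv:2406.19378 (the name "Kikuchi matrix",
  guided Hamiltonian `K_ℓ`).
* M. B. Hastings, *Classical and quantum algorithms for tensor principal component analysis*,
  Quantum 4, 237 (2020).
-/

namespace Literature.Computability.QuantumAlgorithms

open Finset Matrix
open scoped symmDiff

namespace KikuchiMatrix

variable {α : Type*} [DecidableEq α] [Fintype α]
variable {R : Type*} [CommRing R]

/-- The index set of the order-`ℓ` matrix: the `ℓ`-element subsets of the ground set.
[cite: WeinElalaouiMoore2019, §3] -/
abbrev Level (α : Type*) [DecidableEq α] [Fintype α] (ℓ : ℕ) : Type _ := {S : Finset α // #S = ℓ}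

/-- The symmetric-difference (Kikuchi) matrix of order `ℓ` of a set function `Y` read on `p`-sets:
`M_{S,T} = Y (S ∆ T)` if `#(S ∆ T) = p`, else `0`.
[cite: WeinElalaouiMoore2019, §3, "The symmetric difference matrix of order ℓ"] -/
def kikuchi (Y : Finset α → R) (p ℓ : ℕ) : Matrix (Level α ℓ) (Level α ℓ) R :=
  fun S T => if #(S.1 ∆ T.1) = p then Y (S.1 ∆ T.1) else 0

/-- Unfolding lemma for `kikuchi`. [cite: WeinElalaouiMoore2019, §3] -/
theorem kikuchi_apply (Y : Finset α → R) (p ℓ : ℕ) (S T : Level α ℓ) :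
    kikuchi Y p ℓ S T = if #(S.1 ∆ T.1) = p then Y (S.1 ∆ T.1) else 0 := rfl

/-- `M` is symmetric. [cite: WeinElalaouiMoore2019, §3 ("the symmetric … matrix")] -/
theorem kikuchi_transpose (Y : Finset α → R) (p ℓ : ℕ) :
    (kikuchi Y p ℓ)ᵀ = kikuchi Y p ℓ := by
  ext S T
  simp only [transpose_apply, kikuchi_apply, symmDiff_comm]

/-- `M` is symmetric (`Matrix.IsSymm` form). [cite: WeinElalaouiMoore2019, §3] -/
theorem kikuchi_isSymm (Y : Finset α → R) (p ℓ : ℕ) : (kikuchi Y p ℓ).IsSymm :=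
  kikuchi_transpose Y p ℓ

/-! ## The monomials `x^S` and the symmetric difference -/

/-- `x^S := ∏_{i ∈ S} x_i`. [cite: WeinElalaouiMoore2019, §3 and §6 (notation `x^S`)] -/
def setProd (x : α → R) (S : Finset α) : R := ∏ i ∈ S, x i

omit [DecidableEq α] [Fintype α] in
/-- `x^S · x^S = 1` when every `x_i x_i = 1`. [folklore] -/
theorem setProd_mul_self (x : α → R) (hx : ∀ i, x i * x i = 1) (S : Finset α) :
    setProd x S * setProd x S = 1 := by
  unfold setProd
  rw [← prod_mul_distrib]
  exact prod_eq_one fun i _ => hx i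

omit [Fintype α] in
/-- `|S ∆ T| + 2 |S ∩ T| = |S| + |T|`. [folklore] -/
theorem card_symmDiff_add (S T : Finset α) : #(S ∆ T) + 2 * #(S ∩ T) = #S + #T := by
  have h1 : S ∆ T = (S \ T) ∪ (T \ S) := symmDiff_def S T
  have hd : Disjoint (S \ T) (T \ S) := disjoint_sdiff_sdiff
  rw [h1, card_union_of_disjoint hd]
  have hS := card_sdiff_add_card_inter S T
  have hT := card_sdiff_add_card_inter T S
  rw [inter_comm T S] at hT
  omega

omit [Fintype α] in
/-- For `±1`-valued `x` (more generally `x_i x_i = 1` in a commutative ring),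
`x^{S ∆ T} = x^S x^T`. [cite: WeinElalaouiMoore2019, §6 (first paragraph)] -/
theorem prod_symmDiff (x : α → R) (hx : ∀ i, x i * x i = 1) (S T : Finset α) :
    setProd x (S ∆ T) = setProd x S * setProd x T := by
  unfold setProd
  have h1 : S ∆ T = (S \ T) ∪ (T \ S) := symmDiff_def S T
  have hd : Disjoint (S \ T) (T \ S) := disjoint_sdiff_sdiff
  rw [h1, prod_union hd]
  have hS : ∏ i ∈ S, x i = (∏ i ∈ S \ T, x i) * ∏ i ∈ S ∩ T, x i := by
    rw [← sdiff_inter_self_left S T, prod_sdiff inter_subset_left]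
  have hT : ∏ i ∈ T, x i = (∏ i ∈ T \ S, x i) * ∏ i ∈ S ∩ T, x i := by
    rw [inter_comm, ← sdiff_inter_self_left T S, prod_sdiff inter_subset_left]
  have hsq : (∏ i ∈ S ∩ T, x i) * ∏ i ∈ S ∩ T, x i = 1 := by
    rw [← prod_mul_distrib]; exact prod_eq_one fun i _ => hx i
  rw [hS, hT]
  calc (∏ i ∈ S \ T, x i) * ∏ i ∈ T \ S, x i
      = ((∏ i ∈ S \ T, x i) * ∏ i ∈ T \ S, x i) * ((∏ i ∈ S ∩ T, x i) * ∏ i ∈ S ∩ T, x i) := by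
        rw [hsq, mul_one]
    _ = (∏ i ∈ S \ T, x i) * (∏ i ∈ S ∩ T, x i) * ((∏ i ∈ T \ S, x i) * ∏ i ∈ S ∩ T, x i) := by
        ring

/-! ## The planted (noiseless rank-one) tensor -/

/-- The noiseless planted tensor `Y_E = λ · x^E` of the spiked tensor model / a fully satisfiable
`k`-XOR instance with planted assignment `x`. [cite: WeinElalaouiMoore2019, §6, display
`Y_{S∆T} = λ x_*^{S∆T} + G_{S∆T}` with the noise `G` set to `0`] -/
def planted (lam : R) (x : α → R) : Finset α → R := fun E => lam * setProd x E

/-- Entries of the Kikuchi matrix of the planted tensor: `λ x^S x^T` on the pattern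
`|S ∆ T| = p`. [cite: WeinElalaouiMoore2019, §6–§6.1] -/
theorem kikuchi_planted_apply (lam : R) (x : α → R) (hx : ∀ i, x i * x i = 1) (p ℓ : ℕ)
    (S T : Level α ℓ) :
    kikuchi (planted lam x) p ℓ S T =
      if #(S.1 ∆ T.1) = p then lam * setProd x S.1 * setProd x T.1 else 0 := by
  simp only [kikuchi_apply, planted, prod_symmDiff x hx, mul_assoc]

/-- The quadratic form of the order-`ℓ` matrix at `u_S = x^S`:
`uᵀ M u = Σ_{S,T : |S ∆ T| = p} Y_{S ∆ T} · x^{S ∆ T}` — the first step of the strong-refutation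
bound `P_Φ(x) ≤ m/2 + C(n,k) ‖M‖ / (2 d_ℓ)` for `k`-XOR and of the detection lower bound
`‖X‖ ≥ uᵀ X u / ‖u‖²`. [cite: WeinElalaouiMoore2019, §11.1.2 (display for `(u^x)ᵀ M u^x`), §7
(proof of Theorem 28)] -/
theorem dotProduct_kikuchi_mulVec (Y : Finset α → R) (x : α → R) (hx : ∀ i, x i * x i = 1)
    (p ℓ : ℕ) :
    (fun S : Level α ℓ => setProd x S.1) ⬝ᵥ (kikuchi Y p ℓ *ᵥ fun T => setProd x T.1)
      = ∑ S : Level α ℓ, ∑ T : Level α ℓ,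
          if #(S.1 ∆ T.1) = p then Y (S.1 ∆ T.1) * setProd x (S.1 ∆ T.1) else 0 := by
  simp only [dotProduct, mulVec, mul_sum]
  refine sum_congr rfl fun S _ => sum_congr rfl fun T _ => ?_
  rw [kikuchi_apply]
  split_ifs
  · rw [prod_symmDiff x hx]; ring
  · rw [zero_mul, mul_zero]

/-- `d(S) :=` the number of `ℓ`-sets `T` with `|S ∆ T| = p` (the degree of `S` in the graph
`J_{n,ℓ,p}`). [cite: WeinElalaouiMoore2019, §3 (definition of `d_ℓ`), §6.1] -/
def adjCount (p ℓ : ℕ) (S : Level α ℓ) : ℕ := #{T : Level α ℓ | #(S.1 ∆ T.1) = p}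

/-- The planted-signal eigenvector relation: with `u_S = x^S`,
`(M u)_S = λ · d(S) · u_S`. [cite: WeinElalaouiMoore2019, §3 (threshold `λ d_ℓ/2`), §11.1.2
(the computation of `(u^x)ᵀ M u^x`)] -/
theorem kikuchi_planted_mulVec (lam : R) (x : α → R) (hx : ∀ i, x i * x i = 1) (p ℓ : ℕ)
    (S : Level α ℓ) :
    (kikuchi (planted lam x) p ℓ *ᵥ fun T => setProd x T.1) S
      = lam * (adjCount p ℓ S : R) * setProd x S.1 := by
  simp only [mulVec, dotProduct, kikuchi_planted_apply lam x hx]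
  have : ∀ T : Level α ℓ,
      (if #(S.1 ∆ T.1) = p then lam * setProd x S.1 * setProd x T.1 else 0) * setProd x T.1
        = if #(S.1 ∆ T.1) = p then lam * setProd x S.1 else 0 := by
    intro T
    split_ifs
    · rw [mul_assoc, setProd_mul_self x hx, mul_one]
    · rw [zero_mul]
  simp_rw [this]
  rw [sum_ite, sum_const_zero, add_zero, sum_const, nsmul_eq_mul, adjCount]
  ring

/-! ## Counting: `d_ℓ = C(ℓ, p/2) · C(n - ℓ, p/2)` -/

section Counting

omit [Fintype α] in
/-- `(S ∖ (S ∖ T)) ∪ (T ∖ S) = T`. [folklore] -/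
private lemma sdiff_sdiff_union_sdiff (S T : Finset α) : (S \ (S \ T)) ∪ (T \ S) = T := by
  ext a; simp only [mem_union, mem_sdiff]; tauto

omit [Fintype α] in
/-- For `A ⊆ S` and `B` disjoint from `S`: `S ∖ ((S ∖ A) ∪ B) = A`. [folklore] -/
private lemma sdiff_sdiff_union_eq {S A B : Finset α} (hA : A ⊆ S) (hB : Disjoint S B) :
    S \ ((S \ A) ∪ B) = A := by
  ext a
  simp only [mem_sdiff, mem_union, not_or]
  constructor
  · rintro ⟨haS, hnot, -⟩
    by_contra haA
    exact hnot ⟨haS, haA⟩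
  · intro haA
    exact ⟨hA haA, fun h => h.2 haA, fun hb => disjoint_left.mp hB (hA haA) hb⟩

omit [Fintype α] in
/-- For `B` disjoint from `S`: `((S ∖ A) ∪ B) ∖ S = B`. [folklore] -/
private lemma sdiff_union_sdiff_eq {S A B : Finset α} (hB : Disjoint S B) :
    ((S \ A) ∪ B) \ S = B := by
  ext a
  simp only [mem_sdiff, mem_union]
  constructor
  · rintro ⟨h | h, hnS⟩
    · exact absurd h.1 hnS
    · exact h
  · intro hb
    exact ⟨Or.inr hb, fun haS => disjoint_left.mp hB haS hb⟩

omit [Fintype α] in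
/-- `|S ∆ T| = |S ∖ T| + |T ∖ S|`. [folklore] -/
theorem card_symmDiff_eq_add (S T : Finset α) : #(S ∆ T) = #(S \ T) + #(T \ S) := by
  have h1 : S ∆ T = (S \ T) ∪ (T \ S) := symmDiff_def S T
  rw [h1, card_union_of_disjoint disjoint_sdiff_sdiff]

/-- The number of `ℓ`-subsets `T` of the ground set with `|S ∆ T| = 2j`, for a fixed `ℓ`-subset
`S`, is `C(ℓ, j) · C(n - ℓ, j)`: `T ↦ (S ∖ T, T ∖ S)` is a bijection onto
(`j`-subsets of `S`) × (`j`-subsets of `Sᶜ`), with inverse `(A, B) ↦ (S ∖ A) ∪ B`.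
[cite: WeinElalaouiMoore2019, §3, "This is the number of sets `T` of size `ℓ` such that
`|S ∆ T| = p` for a given set `S` of size `ℓ`" (definition of `d_ℓ`); the bijection is folklore] -/
theorem card_filter_card_symmDiff_eq (S : Finset α) {ℓ : ℕ} (hS : #S = ℓ) (j : ℕ) :
    #{T ∈ (univ : Finset α).powersetCard ℓ | #(S ∆ T) = 2 * j}
      = ℓ.choose j * (Fintype.card α - ℓ).choose j := by
  have hG : #(S.powersetCard j ×ˢ Sᶜ.powersetCard j) = ℓ.choose j * (Fintype.card α - ℓ).choose j := by
    rw [card_product, card_powersetCard, card_powersetCard, card_compl, hS]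
  rw [← hG]
  apply card_nbij' (fun T => (S \ T, T \ S)) (fun AB => (S \ AB.1) ∪ AB.2)
  · intro T hT
    simp only [coe_filter, Set.mem_setOf_eq, mem_powersetCard] at hT
    obtain ⟨⟨-, hTℓ⟩, hST⟩ := hT
    simp only [coe_product, Set.mem_prod, mem_coe, mem_powersetCard]
    have h1 := card_sdiff_add_card_inter S T
    have h2 := card_sdiff_add_card_inter T S
    rw [inter_comm T S] at h2
    have h5 := card_symmDiff_eq_add S T
    refine ⟨⟨sdiff_subset, by omega⟩, fun a ha => ?_, by omega⟩
    rw [mem_compl]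
    exact (mem_sdiff.mp ha).2
  · rintro ⟨A, B⟩ hAB
    simp only [coe_product, Set.mem_prod, mem_coe, mem_powersetCard] at hAB
    obtain ⟨⟨hA, hAj⟩, hB, hBj⟩ := hAB
    simp only [coe_filter, Set.mem_setOf_eq, mem_powersetCard]
    have hdisj : Disjoint S B := by
      rw [disjoint_left]
      intro a haS hb
      have := hB hb
      rw [mem_compl] at this
      exact this haS
    have hdisj' : Disjoint (S \ A) B := hdisj.mono_left sdiff_subset
    have hcardSA : #(S \ A) = ℓ - j := by
      have := card_sdiff_add_card_inter S A
      rw [inter_eq_right.mpr hA] at this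
      omega
    have hjl : j ≤ ℓ := by
      rw [← hAj, ← hS]; exact card_le_card hA
    refine ⟨⟨subset_univ _, ?_⟩, ?_⟩
    · rw [card_union_of_disjoint hdisj', hcardSA, hBj]; omega
    · rw [card_symmDiff_eq_add, sdiff_sdiff_union_eq hA hdisj, sdiff_union_sdiff_eq hdisj, hAj, hBj]
      ring
  · intro T _
    exact sdiff_sdiff_union_sdiff S T
  · rintro ⟨A, B⟩ hAB
    simp only [coe_product, Set.mem_prod, mem_coe, mem_powersetCard] at hAB
    obtain ⟨⟨hA, -⟩, hB, -⟩ := hAB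
    have hdisj : Disjoint S B := by
      rw [disjoint_left]
      intro a haS hb
      have := hB hb
      rw [mem_compl] at this
      exact this haS
    exact Prod.ext (sdiff_sdiff_union_eq hA hdisj) (sdiff_union_sdiff_eq hdisj)

/-- `adjCount` as a count over the `ℓ`-subsets of the ground set. [folklore] -/
theorem adjCount_eq_card_filter (p ℓ : ℕ) (S : Level α ℓ) :
    adjCount p ℓ S = #{T ∈ (univ : Finset α).powersetCard ℓ | #(S.1 ∆ T) = p} := by
  unfold adjCount
  apply card_bij (fun T _ => T.1)
  · intro T hT
    simp only [mem_filter, mem_univ, true_and] at hT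
    simp only [mem_filter, mem_powersetCard]
    exact ⟨⟨subset_univ _, T.2⟩, hT⟩
  · intro T₁ _ T₂ _ h
    exact Subtype.ext h
  · intro T hT
    simp only [mem_filter, mem_powersetCard] at hT
    exact ⟨⟨T, hT.1.2⟩, by simp only [mem_filter, mem_univ, true_and]; exact hT.2, rfl⟩

/-- `d_ℓ = C(ℓ, p/2) · C(n - ℓ, p/2)` for even `p = 2j`, for every `ℓ`-set `S`.
[cite: WeinElalaouiMoore2019, §3 (definition of `d_ℓ`) and §11.1.2] -/
theorem adjCount_eq (ℓ j : ℕ) (S : Level α ℓ) :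
    adjCount (2 * j) ℓ S = ℓ.choose j * (Fintype.card α - ℓ).choose j := by
  rw [adjCount_eq_card_filter, card_filter_card_symmDiff_eq S.1 S.2 j]

/-- For `|S| = |T|` the symmetric difference has even size, so the order-`ℓ` matrix read on
`p`-sets is identically zero-patterned for odd `p`. [cite: WeinElalaouiMoore2019, §3 ("Let `p`
be even"), §6.1 ("equivalently `|S ∩ T| = ℓ - p/2`")] -/
theorem adjCount_eq_zero_of_odd {p : ℕ} (hp : Odd p) (ℓ : ℕ) (S : Level α ℓ) :
    adjCount p ℓ S = 0 := by
  unfold adjCount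
  rw [card_eq_zero, filter_eq_empty_iff]
  intro T _ hT
  have h := card_symmDiff_add S.1 T.1
  rw [S.2, T.2, hT] at h
  obtain ⟨r, hr⟩ := hp
  omega

/-- The planted vector `u_S = x^S` is an exact eigenvector of the order-`ℓ` matrix of the
noiseless planted tensor read on `2j`-sets, with eigenvalue `λ · C(ℓ, j) · C(n - ℓ, j) = λ d_ℓ`.
[cite: WeinElalaouiMoore2019, §3 (Algorithm 9, Theorem 11: threshold `λ d_ℓ / 2`), §7 proof of
Theorem 28 (the computation of `uᵀ X u`)] -/
theorem kikuchi_planted_mulVec_eq_smul (lam : R) (x : α → R) (hx : ∀ i, x i * x i = 1)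
    (ℓ j : ℕ) :
    (kikuchi (planted lam x) (2 * j) ℓ *ᵥ fun T => setProd x T.1)
      = (lam * ((ℓ.choose j * (Fintype.card α - ℓ).choose j : ℕ) : R)) • fun T => setProd x T.1 := by
  ext S
  rw [kikuchi_planted_mulVec lam x hx, adjCount_eq, Pi.smul_apply, smul_eq_mul]

end Counting

/-! ## Counting pairs with a prescribed symmetric difference (the `k`-XOR quadratic form)

For a fixed `k`-set `U` (`k = 2j`) the number of ordered pairs `(S, T)` of `ℓ`-sets with
`S ∆ T = U` is `C(k, k/2) · C(n - k, ℓ - k/2)`: such a pair is `S = A ∪ W`, `T = (U ∖ A) ∪ W` with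
`A = S ∩ U` a `k/2`-subset of `U` and `W = S ∖ U = S ∩ T` an `(ℓ - k/2)`-subset of `Uᶜ`.  This is the
count "for any fixed `U_i` (of size `k`), the number of `(S,T)` pairs such that `S ∆ T = U_i` is
`C(n,ℓ) d_ℓ C(n,k)⁻¹`" of [cite: WeinElalaouiMoore2019, §11.1.2] (the two expressions agree by
double counting; we prove the closed product form), which turns `dotProduct_kikuchi_mulVec` into
`(u^x)ᵀ M u^x = C(k,k/2) C(n-k,ℓ-k/2) · Σ_i b_i x^{U_i}` for a `k`-XOR instance. -/

section PairCount

omit [Fintype α] in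
/-- If `S ∆ T = U` then `S ∩ U = S ∖ T`. [folklore] -/
private lemma inter_eq_sdiff_of_symmDiff_eq {S T U : Finset α} (h : S ∆ T = U) : S ∩ U = S \ T := by
  ext a
  rw [← h]
  simp only [mem_inter, mem_symmDiff, mem_sdiff]
  tauto

omit [Fintype α] in
/-- If `S ∆ T = U` then `S ∖ U = S ∩ T`. [folklore] -/
private lemma sdiff_eq_inter_of_symmDiff_eq {S T U : Finset α} (h : S ∆ T = U) : S \ U = S ∩ T := by
  ext a
  rw [← h]
  simp only [mem_inter, mem_symmDiff, mem_sdiff]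
  tauto

omit [Fintype α] in
/-- Reassembling `T` from `U = S ∆ T`, `A = S ∩ U`, `W = S ∖ U`: `(U ∖ (S ∩ U)) ∪ (S ∖ U) = T`.
[folklore] -/
private lemma sdiff_inter_union_sdiff_eq {S T U : Finset α} (h : S ∆ T = U) :
    (U \ (S ∩ U)) ∪ (S \ U) = T := by
  ext a
  rw [← h]
  simp only [mem_union, mem_sdiff, mem_inter, mem_symmDiff]
  tauto

omit [Fintype α] in
/-- For `A ⊆ U` and `W` disjoint from `U`: `(A ∪ W) ∆ ((U ∖ A) ∪ W) = U`. [folklore] -/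
private lemma union_symmDiff_sdiff_union {A W U : Finset α} (hA : A ⊆ U) (hW : Disjoint W U) :
    (A ∪ W) ∆ ((U \ A) ∪ W) = U := by
  ext a
  simp only [mem_symmDiff, mem_union, mem_sdiff]
  have h1 : a ∈ A → a ∈ U := fun h => hA h
  have h2 : a ∈ W → a ∉ U := fun h hu => disjoint_left.mp hW h hu
  tauto

/-- **Pairs with prescribed symmetric difference.** For a `2j`-set `U` and `j ≤ ℓ`, the number of
ordered pairs `(S, T)` of `ℓ`-subsets of the ground set with `S ∆ T = U` is
`C(2j, j) · C(n - 2j, ℓ - j)`. [cite: WeinElalaouiMoore2019, §11.1.2 ("for any fixed `U_i` (of size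
`k`), the number of `(S,T)` pairs such that `S ∆ T = U_i` is …"; closed form and bijection folklore)] -/
theorem card_filter_symmDiff_eq (U : Finset α) {j : ℕ} (hU : #U = 2 * j) {ℓ : ℕ} (hj : j ≤ ℓ) :
    #{ST ∈ (univ : Finset α).powersetCard ℓ ×ˢ (univ : Finset α).powersetCard ℓ | ST.1 ∆ ST.2 = U}
      = (2 * j).choose j * (Fintype.card α - 2 * j).choose (ℓ - j) := by
  have hG : #(U.powersetCard j ×ˢ Uᶜ.powersetCard (ℓ - j))
      = (2 * j).choose j * (Fintype.card α - 2 * j).choose (ℓ - j) := by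
    rw [card_product, card_powersetCard, card_powersetCard, card_compl, hU]
  rw [← hG]
  apply card_nbij' (fun ST => (ST.1 ∩ U, ST.1 \ U)) (fun AW => (AW.1 ∪ AW.2, (U \ AW.1) ∪ AW.2))
  · rintro ⟨S, T⟩ hST
    simp only [coe_filter, Set.mem_setOf_eq, mem_product, mem_powersetCard] at hST
    obtain ⟨⟨⟨-, hSℓ⟩, -, hTℓ⟩, hSTU⟩ := hST
    simp only [coe_product, Set.mem_prod, mem_coe, mem_powersetCard]
    have h1 := card_sdiff_add_card_inter S T
    have h2 := card_sdiff_add_card_inter T S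
    rw [inter_comm T S] at h2
    have h5 := card_symmDiff_eq_add S T
    rw [hSTU, hU] at h5
    have hA : #(S ∩ U) = j := by rw [inter_eq_sdiff_of_symmDiff_eq hSTU]; omega
    refine ⟨⟨inter_subset_right, hA⟩, fun a ha => ?_, ?_⟩
    · rw [mem_compl]; exact (mem_sdiff.mp ha).2
    · have := card_sdiff_add_card_inter S U
      omega
  · rintro ⟨A, W⟩ hAW
    simp only [coe_product, Set.mem_prod, mem_coe, mem_powersetCard] at hAW
    obtain ⟨⟨hA, hAj⟩, hW, hWj⟩ := hAW
    have hWU : Disjoint W U := by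
      rw [disjoint_left]; intro a hw hu
      have := hW hw; rw [mem_compl] at this; exact this hu
    have hAWd : Disjoint A W := by
      rw [disjoint_left]; intro a ha hw
      exact disjoint_left.mp hWU hw (hA ha)
    have hUAW : Disjoint (U \ A) W := by
      rw [disjoint_left]; intro a hua hw
      exact disjoint_left.mp hWU hw (mem_sdiff.mp hua).1
    have hUA : #(U \ A) = j := by
      have := card_sdiff_add_card_inter U A
      rw [inter_eq_right.mpr hA] at this
      omega
    simp only [coe_filter, Set.mem_setOf_eq, mem_product, mem_powersetCard]
    refine ⟨⟨⟨subset_univ _, ?_⟩, subset_univ _, ?_⟩, union_symmDiff_sdiff_union hA hWU⟩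
    · rw [card_union_of_disjoint hAWd, hAj, hWj]; omega
    · rw [card_union_of_disjoint hUAW, hUA, hWj]; omega
  · rintro ⟨S, T⟩ hST
    simp only [coe_filter, Set.mem_setOf_eq, mem_product, mem_powersetCard] at hST
    obtain ⟨-, hSTU⟩ := hST
    refine Prod.ext ?_ (sdiff_inter_union_sdiff_eq hSTU)
    ext a
    simp only [mem_union, mem_inter, mem_sdiff]
    tauto
  · rintro ⟨A, W⟩ hAW
    simp only [coe_product, Set.mem_prod, mem_coe, mem_powersetCard] at hAW
    obtain ⟨⟨hA, -⟩, hW, -⟩ := hAW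
    have h1 : ∀ a, a ∈ A → a ∈ U := fun a h => hA h
    have h2 : ∀ a, a ∈ W → a ∉ U := fun a h hu => by
      have := hW h; rw [mem_compl] at this; exact this hu
    refine Prod.ext ?_ ?_
    · ext a
      simp only [mem_inter, mem_union]
      have := h1 a; have := h2 a; tauto
    · ext a
      simp only [mem_sdiff, mem_union]
      have := h1 a; have := h2 a; tauto

end PairCount

end KikuchiMatrix

end Literature.Computability.QuantumAlgorithms
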